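import Summits.HodgeConjecture.HodgeConjecture.Theorems.F0D9opRoad2PenCongruence
import HarnessLib

/-!
# `F0D9opRoad2Descent` — ★ RE-HOME of `Lines/F0_D9opRoad2.lean`, PART 4 of 6 (size-lint split; cut at a declaration boundary).

Imports (bare lines; provenance here): `Theorems.F0D9opRoad2PenCongruence` = ★ the previous part of the same `Lines` workfile (size-lint split ×6) · `HarnessLib`.
See PART 1 `Theorems/F0D9opRoad2Boundary.lean` for the full re-home header and the original module docstring (verbatim there). Namespaces and sections KEPT
(re-opened below exactly as they stand at the cut, with their `open`∕`variable` lines replayed); code bytes = the workfile՚s, docstrings included; options preamble repeated from PART 1.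
HC_CM is proved only modulo the 7 printed citations (2 remaining: hLiu418 = stmt-HodgeConjecture-24832, h413 = stmt-HodgeConjecture-24833) until rung 0 closes; a re-home is count-neutral. -/

namespace Summit.HodgeConjecture.HodgeConjecture.Cruxes.HLiu418.F0D9opRoad2
set_option linter.dupNamespace false  -- `Summit.HodgeConjecture.HodgeConjecture.…` BY DESIGN (D-0017), as in `Lines/d6_cm_curve.lean`
open CategoryTheory NumberField IsDedekindDomain MulAction
open scoped Matrix MonObj CategoryTheory.Obj
open MonoidalCategory
open Summit.HodgeConjecture.CorCM.Lines.A3Liu418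
open Literature.AlgebraicGeometry.Motives (AbelianVariety)
open Literature.AlgebraicGeometry.Motives.AbelianVariety (rationalTateModuleMap frobeniusHom zsmul_eq_zsmul_trace_comp_of_pin
  exists_finite_forall_exists_goodReductionAt_homReduction_tateSpecialisation)
open Literature.NumberTheory.GaloisRepresentations
open Literature.NumberTheory.Automorphic Literature.NumberTheory.Automorphic.UnitaryGroup
open Literature.AlgebraicGeometry.ShimuraVarieties.UnitaryCanonicalModel
open Literature.NumberTheory.Automorphic.Liu2021.AppendixC
open Literature.AlgebraicGeometry.Motives (AlgPoints IntegralModel frobeniusOver SchemeOver)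
open Literature.NumberTheory.DiophantineGeometry (geomResidueField)

section Edition5Desk
open Literature.NumberTheory.EllipticCurves (genericFibre)
open Literature.NumberTheory.DiophantineGeometry (specialFibreFunctor)
open IsLocalRing (closedPoint)

namespace PenLemmas
open AlgebraicGeometry CategoryTheory.Limits IsDedekindDomain.HeightOneSpectrum IsLocalRing
open Literature.NumberTheory.DiophantineGeometry (specResidueField)


/-! ### §4b (ED. 5.3, row (b15)) The PEN′ stage B WITHOUT descent: the MODv3 block (γ″) at `(Kc, 𝒮c)` from MOD (1)–(6), Γ3-Q, DEG and FULL -/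

/-- **PEN′ stage B′ — the (γ″) block of `RecordCurveCongruenceOnPointsCofinal` at `(Kc, 𝒮c)`** from the inner `∀ K₁ …` package `hMOD₁`
of MOD (verbatim), Γ3-Q, DEG and FULL: at `(N′, rc₁, rc₂, x′)` build `K₁ = Kc ∩ t₁ Kc t₁⁻¹` (★ p809676), `ht₂` = DEG (c), unpack MOD at
`(K₁, hle, ht, hK₁, ht₂)`, full fibres from FULL ∘ ★ p810526 ∘ DEG (a), the Γ3-Q lift (surjective, hence bijective by counting), then the
§2 CORE `finsum_translate_eq_of_two_sections` IS the identity — `congruenceOnPoints_at_of_letters` with the DESC step and the push-forward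
deleted.  Stated with the (γ″) block as a Π-conclusion so that `modv3_of_modv2` closes by ONE anonymous constructor (no trailing `?_`).
[cite: Liu2021, Prop. D.8 (1)–(3) and proof of Cor. D.9 p. 139 L4–L31] -/
theorem congruenceOnPointsCofinal_block_of_letters
    (hQ : HeckeSumReindexing) (hDEG : HeckeDegreeSplitPlace) (hFULL : RecordNeatLevelFullFibres)
    (F : Type) [Field F] [NumberField F] [IsCMField F] [IsGalois ℚ F] (ι₁ : F →+* ℂ)
    (Jstar : Matrix (Fin 2) (Fin 2) F)
    (K₀ : C5.OpenCompactSubgroup ↥(finAdelic ↥(maximalRealSubfield F) F (IsCMField.complexConj F) 2 Jstar))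
    (S : RecordSystemGS F Jstar ι₁ K₀) (hU7ₛ : S.HeckeTranslateDefinedOver)
    (hJ : (Jstar.map (IsCMField.complexConj F))ᵀ = Jstar) (hJu : IsUnit Jstar)
    (w : HeightOneSpectrum (𝓞 F)) (hw : (IsCMField.complexConj F) • w ≠ w)
    (hJi : (UnitaryGroup.isUnit_placeForm Jstar hJu w).unit ∈ glInt 2 (w.adicCompletion F))
    (Kc : C5.SmallLevel K₀)
    (hKc : UnitaryGroup.IsHyperspecialAt ↥(maximalRealSubfield F) F (IsCMField.complexConj F) 2 Jstar Kc.1.1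
      (w.under (𝓞 ↥(maximalRealSubfield F))))
    (𝒮c : IntegralModel (HeightOneSpectrum.valuationSubringAtPrime F w) F (S.M.obj Kc)) [IsProper 𝒮c.total.hom]
    (hMOD₁ :
           ∀ (K₁ : C5.SmallLevel K₀) (hle : K₁ ≤ Kc)
             (ht : C5.HeckeLE
                (UnitaryGroup.heckeElementAt ↥(maximalRealSubfield F) F (IsCMField.complexConj F) 2 Jstar
                    (⟨w, rfl⟩ : UnitaryGroup.PlacesOver F (w.under (𝓞 ↥(maximalRealSubfield F))))
                    (IsCMField.complexConj_ne_one F) hJ hw (UnitaryGroup.isUnit_placeForm Jstar hJu w) (HeckeCharacter.uniformizer F w) 1 :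
                  ↥(finAdelic ↥(maximalRealSubfield F) F (IsCMField.complexConj F) 2 Jstar)) K₁ Kc)
             (_hK₁ : (K₁.1.1 : Subgroup ↥(finAdelic ↥(maximalRealSubfield F) F (IsCMField.complexConj F) 2 Jstar))
                = Kc.1.1 ⊓ (Kc.1.1).map (MulAut.conj
                    (UnitaryGroup.heckeElementAt ↥(maximalRealSubfield F) F (IsCMField.complexConj F) 2 Jstar
                      (⟨w, rfl⟩ : UnitaryGroup.PlacesOver F (w.under (𝓞 ↥(maximalRealSubfield F))))
                      (IsCMField.complexConj_ne_one F) hJ hw (UnitaryGroup.isUnit_placeForm Jstar hJu w) (HeckeCharacter.uniformizer F w) 1 :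
                    ↥(finAdelic ↥(maximalRealSubfield F) F (IsCMField.complexConj F) 2 Jstar))).toMonoidHom)
             (ht₂ : C5.HeckeLE
                (UnitaryGroup.heckeElementAt ↥(maximalRealSubfield F) F (IsCMField.complexConj F) 2 Jstar
                    (⟨w, rfl⟩ : UnitaryGroup.PlacesOver F (w.under (𝓞 ↥(maximalRealSubfield F))))
                    (IsCMField.complexConj_ne_one F) hJ hw (UnitaryGroup.isUnit_placeForm Jstar hJu w) (HeckeCharacter.uniformizer F w) 2 :
                  ↥(finAdelic ↥(maximalRealSubfield F) F (IsCMField.complexConj F) 2 Jstar)) Kc Kc),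
           ∃ (𝒯 : IntegralModel (HeightOneSpectrum.valuationSubringAtPrime F w) F (S.M.obj K₁))
             (_h𝒯 : AlgebraicGeometry.IsProper 𝒯.total.hom)
             (π₁ π₂ : 𝒯.total ⟶ 𝒮c.total)
             (_hflat : AlgebraicGeometry.Flat π₁.left) (_hlfp : AlgebraicGeometry.LocallyOfFinitePresentation π₁.left)
             (_hfin : AlgebraicGeometry.IsFinite π₁.left)
             (_hπ₁ : (genericFibre (HeightOneSpectrum.valuationSubringAtPrime F w) F).map π₁ ≫ 𝒮c.genericIso'.hom
                = 𝒯.genericIso'.hom ≫ S.M.map (homOfLE hle))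
             (_hπ₂ : (genericFibre (HeightOneSpectrum.valuationSubringAtPrime F w) F).map π₂ ≫ 𝒮c.genericIso'.hom
                = 𝒯.genericIso'.hom ≫ Literature.NumberTheory.Automorphic.Liu2021.AppendixC.recordHeckeTranslateGS S hU7ₛ _ K₁ Kc ht)
             (s s' : AlgPoints 𝒮c.reductionAt (geomResidueField w) → AlgPoints 𝒯.reductionAt (geomResidueField w))
             (V : (𝒯.reductionAt).left.Opens)
             (_hV : AlgebraicGeometry.IsOpenImmersion (V.ι ≫ ((specialFibreFunctor w).map π₁).left)),
             haveI : AlgebraicGeometry.IsProper 𝒯.total.hom := _h𝒯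
             (∀ (z : AlgPoints 𝒯.reductionAt (geomResidueField w)) (yb : AlgPoints 𝒮c.reductionAt (geomResidueField w)),
                 AlgPoints.map ((specialFibreFunctor w).map π₁) z = yb → z = s yb ∨ z = s' yb) ∧
             (∀ yb : AlgPoints 𝒮c.reductionAt (geomResidueField w), AlgPoints.map ((specialFibreFunctor w).map π₁) (s yb) = yb) ∧
             (∀ yb : AlgPoints 𝒮c.reductionAt (geomResidueField w), AlgPoints.map ((specialFibreFunctor w).map π₁) (s' yb) = yb) ∧
             (∀ yb : AlgPoints 𝒮c.reductionAt (geomResidueField w),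
                 s yb ≠ s' yb → (s yb).toSpecHom.base (closedPoint (geomResidueField w)) ∈ V) ∧
             (∀ yb : AlgPoints 𝒮c.reductionAt (geomResidueField w),
                 AlgPoints.map ((specialFibreFunctor w).map π₂) (s yb) = AlgPoints.map (frobeniusOver 𝒮c.reductionAt) yb) ∧
             (∀ y : AlgPoints (S.M.obj Kc) (AlgebraicClosure (w.adicCompletion F)),
                 AlgPoints.map (frobeniusOver 𝒮c.reductionAt)
                     (AlgPoints.map ((specialFibreFunctor w).map π₂) (s' (𝒮c.geomReductionMap y)))
                   = 𝒮c.geomReductionMap (AlgPoints.map (Literature.NumberTheory.Automorphic.Liu2021.AppendixC.recordHeckeTranslateGS S hU7ₛ _ Kc Kc ht₂) y)))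
    :
           ∀ (N' : C5.SmallLevel K₀) (hN'Kc : N' ≤ Kc)
             (rc₁ : orbit (Kc.1.1 : Subgroup ↥(finAdelic ↥(maximalRealSubfield F) F (IsCMField.complexConj F) 2 Jstar))
                  ((UnitaryGroup.heckeElementAt ↥(maximalRealSubfield F) F (IsCMField.complexConj F) 2 Jstar
                      (⟨w, rfl⟩ : UnitaryGroup.PlacesOver F (w.under (𝓞 ↥(maximalRealSubfield F))))
                      (IsCMField.complexConj_ne_one F) hJ hw (UnitaryGroup.isUnit_placeForm Jstar hJu w) (HeckeCharacter.uniformizer F w) 1 :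
                    ↥(finAdelic ↥(maximalRealSubfield F) F (IsCMField.complexConj F) 2 Jstar)) :
                    ↥(finAdelic ↥(maximalRealSubfield F) F (IsCMField.complexConj F) 2 Jstar) ⧸
                      (Kc.1.1 : Subgroup ↥(finAdelic ↥(maximalRealSubfield F) F (IsCMField.complexConj F) 2 Jstar))) →
                ↥(finAdelic ↥(maximalRealSubfield F) F (IsCMField.complexConj F) 2 Jstar)),
             (∀ β, ((rc₁ β : ↥(finAdelic ↥(maximalRealSubfield F) F (IsCMField.complexConj F) 2 Jstar)) :
                 ↥(finAdelic ↥(maximalRealSubfield F) F (IsCMField.complexConj F) 2 Jstar) ⧸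
                   (Kc.1.1 : Subgroup ↥(finAdelic ↥(maximalRealSubfield F) F (IsCMField.complexConj F) 2 Jstar))) = β.1) →
             ∀ (hrcN₁ : ∀ β, C5.HeckeLE (rc₁ β) N' Kc)
               (rc₂ : orbit (Kc.1.1 : Subgroup ↥(finAdelic ↥(maximalRealSubfield F) F (IsCMField.complexConj F) 2 Jstar))
                  ((UnitaryGroup.heckeElementAt ↥(maximalRealSubfield F) F (IsCMField.complexConj F) 2 Jstar
                      (⟨w, rfl⟩ : UnitaryGroup.PlacesOver F (w.under (𝓞 ↥(maximalRealSubfield F))))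
                      (IsCMField.complexConj_ne_one F) hJ hw (UnitaryGroup.isUnit_placeForm Jstar hJu w) (HeckeCharacter.uniformizer F w) 2 :
                    ↥(finAdelic ↥(maximalRealSubfield F) F (IsCMField.complexConj F) 2 Jstar)) :
                    ↥(finAdelic ↥(maximalRealSubfield F) F (IsCMField.complexConj F) 2 Jstar) ⧸
                      (Kc.1.1 : Subgroup ↥(finAdelic ↥(maximalRealSubfield F) F (IsCMField.complexConj F) 2 Jstar))) →
                ↥(finAdelic ↥(maximalRealSubfield F) F (IsCMField.complexConj F) 2 Jstar)),
             (∀ β, ((rc₂ β : ↥(finAdelic ↥(maximalRealSubfield F) F (IsCMField.complexConj F) 2 Jstar)) :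
                 ↥(finAdelic ↥(maximalRealSubfield F) F (IsCMField.complexConj F) 2 Jstar) ⧸
                   (Kc.1.1 : Subgroup ↥(finAdelic ↥(maximalRealSubfield F) F (IsCMField.complexConj F) 2 Jstar))) = β.1) →
             ∀ (hrcN₂ : ∀ β, C5.HeckeLE (rc₂ β) N' Kc),
             ∀ x' : AlgPoints (S.M.obj N') (AlgebraicClosure (w.adicCompletion F)),
               ∑ᶠ β, ({AlgPoints.map (frobeniusOver 𝒮c.reductionAt)
                          (𝒮c.geomReductionMap (AlgPoints.map (recordHeckeTranslateGS S hU7ₛ (rc₁ β) N' Kc (hrcN₁ β)) x'))} :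
                        Multiset (AlgPoints 𝒮c.reductionAt (geomResidueField w)))
                 = {AlgPoints.map (frobeniusOver 𝒮c.reductionAt) (AlgPoints.map (frobeniusOver 𝒮c.reductionAt)
                       (𝒮c.geomReductionMap (AlgPoints.map (S.M.map (homOfLE hN'Kc)) x')))}
                   + ∑ᶠ β, Ideal.absNorm w.asIdeal •
                       ({𝒮c.geomReductionMap (AlgPoints.map (recordHeckeTranslateGS S hU7ₛ (rc₂ β) N' Kc (hrcN₂ β)) x')} :
                         Multiset (AlgPoints 𝒮c.reductionAt (geomResidueField w))) := by
  intro N' hN'Kc rc₁ hrc₁ hrcN₁ rc₂ hrc₂ hrcN₂ x'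
  have hDEGx := hDEG F Jstar hJ hJu Kc.1.1 w hw hJi hKc
  obtain ⟨hdeg₁, hdeg₂, hnorm⟩ := hDEGx
  have hK₁x := C5.SmallLevel.exists_le_le_heckeLevel_val_eq Kc
    (UnitaryGroup.heckeElementAt ↥(maximalRealSubfield F) F (IsCMField.complexConj F) 2 Jstar
             (⟨w, rfl⟩ : UnitaryGroup.PlacesOver F (w.under (𝓞 ↥(maximalRealSubfield F))))
             (IsCMField.complexConj_ne_one F) hJ hw (UnitaryGroup.isUnit_placeForm Jstar hJu w) (HeckeCharacter.uniformizer F w) 1 :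
           ↥(finAdelic ↥(maximalRealSubfield F) F (IsCMField.complexConj F) 2 Jstar))
  obtain ⟨K₁, hle, _, ht, hK₁⟩ := hK₁x
  have hMODy := hMOD₁ K₁ hle ht hK₁ hnorm
  obtain ⟨𝒯, h𝒯, π₁, π₂, hflat, hlfp, hfin, hπ₁, hπ₂, s, s', V, hV, hcov, hs, _hs', hVs, hs₂, hs'₂⟩ := hMODy
  -- full fibres: FULL at `(Kc, K₁)` (hypothesis-free), `[Kc : K₁] = #orbit_Kc(t₁ Kc)` (★ p810526), DEG (a) at `Kc`
  have h7 : Nat.card {y : AlgPoints (S.M.obj K₁) (AlgebraicClosure (w.adicCompletion F)) //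
          AlgPoints.map (S.M.map (homOfLE hle)) y = (AlgPoints.map (S.M.map (homOfLE hN'Kc)) x')} = Ideal.absNorm w.asIdeal + 1 :=
    (hFULL F ι₁ Jstar K₀ S hJ hJu Kc K₁ hle w (AlgPoints.map (S.M.map (homOfLE hN'Kc)) x')).trans (by
      rw [hK₁, Literature.GroupTheory.Index.relIndex_inf_map_conj_eq_natCard_orbit]
      exact hdeg₁)
  haveI : IsProper 𝒯.total.hom := h𝒯
  haveI : Flat π₁.left := hflat
  haveI : LocallyOfFinitePresentation π₁.left := hlfp
  haveI : IsFinite π₁.left := hfin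
  haveI : IsOpenImmersion (V.ι ≫ ((specialFibreFunctor w).map π₁).left) := hV
  have hQx := hQ F ι₁ Jstar K₀ S hU7ₛ hJ hJu Kc w hw K₁ hle ht hK₁ N' hN'Kc rc₁ hrc₁ hrcN₁ x'
  obtain ⟨lift, hsurj, hliftT⟩ := hQx
  -- the lift is bijective by counting (`#orbit = N w + 1 = #fibre`)
  haveI := Nat.finite_of_card_ne_zero (ne_of_eq_of_ne hdeg₁ (Nat.succ_ne_zero _))
  have hinj : Function.Injective lift := (hsurj.bijective_of_nat_card_le (hdeg₁.trans h7.symm).le).1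
  -- the CORE (§2) at `(Kc, 𝒮c, N′, rc₁, rc₂, x′)` IS the (γ″) identity
  exact finsum_translate_eq_of_two_sections F ι₁ Jstar K₀ S hU7ₛ Kc w 𝒮c _ _ K₁ hle ht hnorm 𝒯 π₁ π₂ hπ₁ hπ₂ s s' V hcov hs hVs
    hs₂ hs'₂ N' hN'Kc rc₁ hrcN₁ x' lift hsurj hinj hliftT hdeg₁ rc₂ hrc₂ hrcN₂ hdeg₂

end PenLemmas

/-! ### ED. 5.3 — DESCENT LEMMAS (row (b14), F0P5a-p02 (g4), 2026-08-31; = A-p05 (g16)՚s HOME cert `F0/P5a/CERT-ED5-Descent.byimport.A-p05g16.lean`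
caae2901092331a1 §1–§2 INLINED VERBATIM (REF1-countersigned; two ★ lemma names fully qualified; §1՚s type variables `ι β γ` renamed `κ τ₁ τ₂` — `ι`, `γ` are notation tokens in this file՚s scope, registrar note (F2)) under the LINE-LOCAL namespace `…F0D9opRoad2.DescentLemmas`,
so that a later Literature filing cannot clash by FQN.  FINITENESS-FREE (unlike ★ p808737 `finsum_congruence_pushforward_reindex`, which asks
`[Finite]` index types — at the liberalised boundary MODv3 no DEG count is available): `Multiset.map ū_v` passes through an ARBITRARY `∑ᶠ`. -/

namespace DescentLemmas

/-! #### §D1 `Multiset.map` through `∑ᶠ` (no finiteness needed) -/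

section MultisetFinsum

variable {κ τ₁ τ₂ : Type*}

/-- `Multiset.map g` commutes with an arbitrary `∑ᶠ` of multisets: `map g` is additive and reflects `0`, so the finite- and
infinite-support cases agree on both sides (`AddMonoidHom.map_finsum_of_preimage_zero`). [folklore] -/
theorem multiset_map_finsum (g : τ₁ → τ₂) (m : κ → Multiset τ₁) :
    Multiset.map g (∑ᶠ i, m i) = ∑ᶠ i, Multiset.map g (m i) := by
  exact (Multiset.mapAddMonoidHom g).map_finsum_of_preimage_zero
    (fun s (hs : Multiset.map g s = 0) => Multiset.map_eq_zero.1 hs) m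

/-- `Multiset.map g (∑ᶠ i, {f i}) = ∑ᶠ i, {g (f i)}`. [folklore] -/
theorem multiset_map_finsum_singleton (g : τ₁ → τ₂) (f : κ → τ₁) :
    Multiset.map g (∑ᶠ i, ({f i} : Multiset τ₁)) = ∑ᶠ i, ({g (f i)} : Multiset τ₂) := by
  rw [multiset_map_finsum]
  simp only [Multiset.map_singleton]

/-- `Multiset.map g (∑ᶠ i, n • {f i}) = ∑ᶠ i, n • {g (f i)}`. [folklore] -/
theorem multiset_map_finsum_nsmul_singleton (g : τ₁ → τ₂) (f : κ → τ₁) (n : ℕ) :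
    Multiset.map g (∑ᶠ i, n • ({f i} : Multiset τ₁)) = ∑ᶠ i, n • ({g (f i)} : Multiset τ₂) := by
  rw [multiset_map_finsum]
  simp only [Multiset.map_nsmul, Multiset.map_singleton]

end MultisetFinsum

/-! #### §D2 The level descent `K̃ → K` of the C3 identity -/

section Descent

variable {F : Type} [Field F] [NumberField F] [IsCMField F] [IsGalois ℚ F] {ι₁ : F →+* ℂ}
  {Jstar : Matrix (Fin 2) (Fin 2) F}
  {K₀ : C5.OpenCompactSubgroup ↥(finAdelic ↥(maximalRealSubfield F) F (IsCMField.complexConj F) 2 Jstar)}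
  (S : RecordSystemGS F Jstar ι₁ K₀) (hU7ₛ : S.HeckeTranslateDefinedOver)
  (hJ : (Jstar.map (IsCMField.complexConj F))ᵀ = Jstar) (hJu : IsUnit Jstar)
  {K Kt : C5.SmallLevel K₀} (hKtK : Kt ≤ K)
  (w : HeightOneSpectrum (𝓞 F)) (hw : (IsCMField.complexConj F) • w ≠ w)
  (𝒮 : IntegralModel (HeightOneSpectrum.valuationSubringAtPrime F w) F (S.M.obj K))
  [AlgebraicGeometry.IsProper 𝒮.total.hom]

set_option maxHeartbeats 400000 in
/-- **ED5-DESCENT.**  The C3 identity at level `K` (model `𝒮`, deeper level `N`, coset families `r₁ r₂`, point `x`) follows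
from the C3 identity at a sub-level `K̃ ≤ K` (model `𝒮̃`, deeper level `N′`, families `r̃₁ r̃₂`, lift `x′`) once a model
morphism `ū : 𝒮̃ ⟶ 𝒮` over the transition map `u_{K̃ → K}` and the «DESC-H» bookkeeping (bijections of the coset carriers +
the two translate identities + the lift) are given: push the `K̃`-identity forward along `ū_v` (C2a + Frobenius naturality) and
reindex.  Road L-B′ of the ED. 5 bridge (F0P5a-plan (g3) 03:21:04Z); record currency, HOME desk only.
(print: Liu2021, Prop. D.8 (1)–(3) and Cor. D.9 proof p. 139) -/
theorem congruenceOnPoints_of_levelDescent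
    -- (i) the model at `K̃ = Kt` and the model morphism `ū` over `u_{K̃ → K}` (C2a binders)
    (𝒮t : IntegralModel (HeightOneSpectrum.valuationSubringAtPrime F w) F (S.M.obj Kt))
    [AlgebraicGeometry.IsProper 𝒮t.total.hom]
    (ū : 𝒮t.total ⟶ 𝒮.total)
    (hū : (genericFibre (HeightOneSpectrum.valuationSubringAtPrime F w) F).map ū ≫ 𝒮.genericIso'.hom =
      𝒮t.genericIso'.hom ≫ S.M.map (homOfLE hKtK))
    -- the C3 data at level `K`
    (N : C5.SmallLevel K₀) (hNK : N ≤ K)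
    (r₁ : orbit (K.1.1 : Subgroup ↥(finAdelic ↥(maximalRealSubfield F) F (IsCMField.complexConj F) 2 Jstar))
          ((UnitaryGroup.heckeElementAt ↥(maximalRealSubfield F) F (IsCMField.complexConj F) 2 Jstar
              (⟨w, rfl⟩ : UnitaryGroup.PlacesOver F (w.under (𝓞 ↥(maximalRealSubfield F))))
              (IsCMField.complexConj_ne_one F) hJ hw (UnitaryGroup.isUnit_placeForm Jstar hJu w) (HeckeCharacter.uniformizer F w) 1 :
            ↥(finAdelic ↥(maximalRealSubfield F) F (IsCMField.complexConj F) 2 Jstar)) :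
            ↥(finAdelic ↥(maximalRealSubfield F) F (IsCMField.complexConj F) 2 Jstar) ⧸
              (K.1.1 : Subgroup ↥(finAdelic ↥(maximalRealSubfield F) F (IsCMField.complexConj F) 2 Jstar))) →
        ↥(finAdelic ↥(maximalRealSubfield F) F (IsCMField.complexConj F) 2 Jstar))
    (hrN₁ : ∀ α, C5.HeckeLE (r₁ α) N K)
    (r₂ : orbit (K.1.1 : Subgroup ↥(finAdelic ↥(maximalRealSubfield F) F (IsCMField.complexConj F) 2 Jstar))
          ((UnitaryGroup.heckeElementAt ↥(maximalRealSubfield F) F (IsCMField.complexConj F) 2 Jstar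
              (⟨w, rfl⟩ : UnitaryGroup.PlacesOver F (w.under (𝓞 ↥(maximalRealSubfield F))))
              (IsCMField.complexConj_ne_one F) hJ hw (UnitaryGroup.isUnit_placeForm Jstar hJu w) (HeckeCharacter.uniformizer F w) 2 :
            ↥(finAdelic ↥(maximalRealSubfield F) F (IsCMField.complexConj F) 2 Jstar)) :
            ↥(finAdelic ↥(maximalRealSubfield F) F (IsCMField.complexConj F) 2 Jstar) ⧸
              (K.1.1 : Subgroup ↥(finAdelic ↥(maximalRealSubfield F) F (IsCMField.complexConj F) 2 Jstar))) →
        ↥(finAdelic ↥(maximalRealSubfield F) F (IsCMField.complexConj F) 2 Jstar))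
    (hrN₂ : ∀ α, C5.HeckeLE (r₂ α) N K)
    (x : AlgPoints (S.M.obj N) (AlgebraicClosure (w.adicCompletion F)))
    -- the (b5) «DESC-H» data at the sub-level `K̃ = Kt`
    (N' : C5.SmallLevel K₀) (hN'N : N' ≤ N) (hN'Kt : N' ≤ Kt)
    (x' : AlgPoints (S.M.obj N') (AlgebraicClosure (w.adicCompletion F)))
    (hx' : AlgPoints.map (S.M.map (homOfLE hN'N)) x' = x)
    (rt₁ : orbit (Kt.1.1 : Subgroup ↥(finAdelic ↥(maximalRealSubfield F) F (IsCMField.complexConj F) 2 Jstar))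
          ((UnitaryGroup.heckeElementAt ↥(maximalRealSubfield F) F (IsCMField.complexConj F) 2 Jstar
              (⟨w, rfl⟩ : UnitaryGroup.PlacesOver F (w.under (𝓞 ↥(maximalRealSubfield F))))
              (IsCMField.complexConj_ne_one F) hJ hw (UnitaryGroup.isUnit_placeForm Jstar hJu w) (HeckeCharacter.uniformizer F w) 1 :
            ↥(finAdelic ↥(maximalRealSubfield F) F (IsCMField.complexConj F) 2 Jstar)) :
            ↥(finAdelic ↥(maximalRealSubfield F) F (IsCMField.complexConj F) 2 Jstar) ⧸
              (Kt.1.1 : Subgroup ↥(finAdelic ↥(maximalRealSubfield F) F (IsCMField.complexConj F) 2 Jstar))) →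
        ↥(finAdelic ↥(maximalRealSubfield F) F (IsCMField.complexConj F) 2 Jstar))
    (hrtN'₁ : ∀ β, C5.HeckeLE (rt₁ β) N' Kt)
    (rt₂ : orbit (Kt.1.1 : Subgroup ↥(finAdelic ↥(maximalRealSubfield F) F (IsCMField.complexConj F) 2 Jstar))
          ((UnitaryGroup.heckeElementAt ↥(maximalRealSubfield F) F (IsCMField.complexConj F) 2 Jstar
              (⟨w, rfl⟩ : UnitaryGroup.PlacesOver F (w.under (𝓞 ↥(maximalRealSubfield F))))
              (IsCMField.complexConj_ne_one F) hJ hw (UnitaryGroup.isUnit_placeForm Jstar hJu w) (HeckeCharacter.uniformizer F w) 2 :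
            ↥(finAdelic ↥(maximalRealSubfield F) F (IsCMField.complexConj F) 2 Jstar)) :
            ↥(finAdelic ↥(maximalRealSubfield F) F (IsCMField.complexConj F) 2 Jstar) ⧸
              (Kt.1.1 : Subgroup ↥(finAdelic ↥(maximalRealSubfield F) F (IsCMField.complexConj F) 2 Jstar))) →
        ↥(finAdelic ↥(maximalRealSubfield F) F (IsCMField.complexConj F) 2 Jstar))
    (hrtN'₂ : ∀ β, C5.HeckeLE (rt₂ β) N' Kt)
    (e₁ : ↥(orbit (K.1.1 : Subgroup ↥(finAdelic ↥(maximalRealSubfield F) F (IsCMField.complexConj F) 2 Jstar))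
            ((UnitaryGroup.heckeElementAt ↥(maximalRealSubfield F) F (IsCMField.complexConj F) 2 Jstar
                (⟨w, rfl⟩ : UnitaryGroup.PlacesOver F (w.under (𝓞 ↥(maximalRealSubfield F))))
                (IsCMField.complexConj_ne_one F) hJ hw (UnitaryGroup.isUnit_placeForm Jstar hJu w) (HeckeCharacter.uniformizer F w) 1 :
              ↥(finAdelic ↥(maximalRealSubfield F) F (IsCMField.complexConj F) 2 Jstar)) :
              ↥(finAdelic ↥(maximalRealSubfield F) F (IsCMField.complexConj F) 2 Jstar) ⧸
                (K.1.1 : Subgroup ↥(finAdelic ↥(maximalRealSubfield F) F (IsCMField.complexConj F) 2 Jstar)))) ≃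
          ↥(orbit (Kt.1.1 : Subgroup ↥(finAdelic ↥(maximalRealSubfield F) F (IsCMField.complexConj F) 2 Jstar))
            ((UnitaryGroup.heckeElementAt ↥(maximalRealSubfield F) F (IsCMField.complexConj F) 2 Jstar
                (⟨w, rfl⟩ : UnitaryGroup.PlacesOver F (w.under (𝓞 ↥(maximalRealSubfield F))))
                (IsCMField.complexConj_ne_one F) hJ hw (UnitaryGroup.isUnit_placeForm Jstar hJu w) (HeckeCharacter.uniformizer F w) 1 :
              ↥(finAdelic ↥(maximalRealSubfield F) F (IsCMField.complexConj F) 2 Jstar)) :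
              ↥(finAdelic ↥(maximalRealSubfield F) F (IsCMField.complexConj F) 2 Jstar) ⧸
                (Kt.1.1 : Subgroup ↥(finAdelic ↥(maximalRealSubfield F) F (IsCMField.complexConj F) 2 Jstar)))))
    (e₂ : ↥(orbit (K.1.1 : Subgroup ↥(finAdelic ↥(maximalRealSubfield F) F (IsCMField.complexConj F) 2 Jstar))
            ((UnitaryGroup.heckeElementAt ↥(maximalRealSubfield F) F (IsCMField.complexConj F) 2 Jstar
                (⟨w, rfl⟩ : UnitaryGroup.PlacesOver F (w.under (𝓞 ↥(maximalRealSubfield F))))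
                (IsCMField.complexConj_ne_one F) hJ hw (UnitaryGroup.isUnit_placeForm Jstar hJu w) (HeckeCharacter.uniformizer F w) 2 :
              ↥(finAdelic ↥(maximalRealSubfield F) F (IsCMField.complexConj F) 2 Jstar)) :
              ↥(finAdelic ↥(maximalRealSubfield F) F (IsCMField.complexConj F) 2 Jstar) ⧸
                (K.1.1 : Subgroup ↥(finAdelic ↥(maximalRealSubfield F) F (IsCMField.complexConj F) 2 Jstar)))) ≃
          ↥(orbit (Kt.1.1 : Subgroup ↥(finAdelic ↥(maximalRealSubfield F) F (IsCMField.complexConj F) 2 Jstar))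
            ((UnitaryGroup.heckeElementAt ↥(maximalRealSubfield F) F (IsCMField.complexConj F) 2 Jstar
                (⟨w, rfl⟩ : UnitaryGroup.PlacesOver F (w.under (𝓞 ↥(maximalRealSubfield F))))
                (IsCMField.complexConj_ne_one F) hJ hw (UnitaryGroup.isUnit_placeForm Jstar hJu w) (HeckeCharacter.uniformizer F w) 2 :
              ↥(finAdelic ↥(maximalRealSubfield F) F (IsCMField.complexConj F) 2 Jstar)) :
              ↥(finAdelic ↥(maximalRealSubfield F) F (IsCMField.complexConj F) 2 Jstar) ⧸
                (Kt.1.1 : Subgroup ↥(finAdelic ↥(maximalRealSubfield F) F (IsCMField.complexConj F) 2 Jstar)))))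
    (hT₁ : ∀ α, AlgPoints.map (recordHeckeTranslateGS S hU7ₛ (r₁ α) N K (hrN₁ α)) x =
      AlgPoints.map (S.M.map (homOfLE hKtK))
        (AlgPoints.map (recordHeckeTranslateGS S hU7ₛ (rt₁ (e₁ α)) N' Kt (hrtN'₁ (e₁ α))) x'))
    (hT₂ : ∀ α, AlgPoints.map (recordHeckeTranslateGS S hU7ₛ (r₂ α) N K (hrN₂ α)) x =
      AlgPoints.map (S.M.map (homOfLE hKtK))
        (AlgPoints.map (recordHeckeTranslateGS S hU7ₛ (rt₂ (e₂ α)) N' Kt (hrtN'₂ (e₂ α))) x'))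
    -- (iii) the C3 identity at `(K̃, 𝒮̃, N′, r̃₁, r̃₂, x′)`
    (hC3t :
      ∑ᶠ β, ({AlgPoints.map (frobeniusOver 𝒮t.reductionAt)
                (𝒮t.geomReductionMap (AlgPoints.map (recordHeckeTranslateGS S hU7ₛ (rt₁ β) N' Kt (hrtN'₁ β)) x'))} :
              Multiset (AlgPoints 𝒮t.reductionAt (geomResidueField w)))
        = {AlgPoints.map (frobeniusOver 𝒮t.reductionAt) (AlgPoints.map (frobeniusOver 𝒮t.reductionAt)
              (𝒮t.geomReductionMap (AlgPoints.map (S.M.map (homOfLE hN'Kt)) x')))}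
          + ∑ᶠ β, Ideal.absNorm w.asIdeal •
              ({𝒮t.geomReductionMap (AlgPoints.map (recordHeckeTranslateGS S hU7ₛ (rt₂ β) N' Kt (hrtN'₂ β)) x')} :
                Multiset (AlgPoints 𝒮t.reductionAt (geomResidueField w)))) :
    -- the C3 identity at `(K, 𝒮, N, r₁, r₂, x)` (`Lines/F0_D9opRoad2.lean` :397–:404 verbatim)
    ∑ᶠ α, ({AlgPoints.map (frobeniusOver 𝒮.reductionAt)
              (𝒮.geomReductionMap (AlgPoints.map (recordHeckeTranslateGS S hU7ₛ (r₁ α) N K (hrN₁ α)) x))} :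
            Multiset (AlgPoints 𝒮.reductionAt (geomResidueField w)))
      = {AlgPoints.map (frobeniusOver 𝒮.reductionAt) (AlgPoints.map (frobeniusOver 𝒮.reductionAt)
            (𝒮.geomReductionMap (AlgPoints.map (S.M.map (homOfLE hNK)) x)))}
        + ∑ᶠ α, Ideal.absNorm w.asIdeal •
            ({𝒮.geomReductionMap (AlgPoints.map (recordHeckeTranslateGS S hU7ₛ (r₂ α) N K (hrN₂ α)) x)} :
              Multiset (AlgPoints 𝒮.reductionAt (geomResidueField w))) := by
  -- package `ūᵥ` on points as an opaque function with C2a and Frobenius naturality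
  obtain ⟨uv, hC2a, hFr⟩ :
      ∃ uv : AlgPoints 𝒮t.reductionAt (geomResidueField w) → AlgPoints 𝒮.reductionAt (geomResidueField w),
        (∀ y : AlgPoints (S.M.obj Kt) (AlgebraicClosure (w.adicCompletion F)),
            𝒮.geomReductionMap (AlgPoints.map (S.M.map (homOfLE hKtK)) y) = uv (𝒮t.geomReductionMap y)) ∧
        (∀ z : AlgPoints 𝒮t.reductionAt (geomResidueField w),
            AlgPoints.map (frobeniusOver 𝒮.reductionAt) (uv z) = uv (AlgPoints.map (frobeniusOver 𝒮t.reductionAt) z)) :=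
    ⟨AlgPoints.map ((specialFibreFunctor w).map ū),
      fun y => Literature.AlgebraicGeometry.Motives.IntegralModel.geomReductionMap_map 𝒮t 𝒮 ū (S.M.map (homOfLE hKtK)) hū y,
      fun z => Literature.AlgebraicGeometry.Motives.AlgPoints.map_frobeniusOver_map ((specialFibreFunctor w).map ū) z⟩
  -- the transition identity `u_{N→K} x = u_{K̃→K} (u_{N′→K̃} x′)`
  have hxK : AlgPoints.map (S.M.map (homOfLE hNK)) x =
      AlgPoints.map (S.M.map (homOfLE hKtK)) (AlgPoints.map (S.M.map (homOfLE hN'Kt)) x') := by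
    rw [← hx', ← AlgPoints.map_comp_apply, ← AlgPoints.map_comp_apply, ← S.M.map_comp, ← S.M.map_comp]
    rfl
  -- LEFT side: rewrite translates, push through `ūᵥ`, reindex along `e₁`
  have hL : ∑ᶠ α, ({AlgPoints.map (frobeniusOver 𝒮.reductionAt)
              (𝒮.geomReductionMap (AlgPoints.map (recordHeckeTranslateGS S hU7ₛ (r₁ α) N K (hrN₁ α)) x))} :
            Multiset (AlgPoints 𝒮.reductionAt (geomResidueField w)))
      = Multiset.map uv
          (∑ᶠ β, ({AlgPoints.map (frobeniusOver 𝒮t.reductionAt)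
                (𝒮t.geomReductionMap (AlgPoints.map (recordHeckeTranslateGS S hU7ₛ (rt₁ β) N' Kt (hrtN'₁ β)) x'))} :
              Multiset (AlgPoints 𝒮t.reductionAt (geomResidueField w)))) := by
    refine Eq.trans ?_ (multiset_map_finsum_singleton _ _).symm
    refine Eq.trans ?_ (finsum_comp_equiv e₁)
    refine finsum_congr fun α => ?_
    simp only [hT₁ α, hC2a, hFr]
  -- RIGHT side, second summand: same with `e₂`, no Frobenius
  have hR₂ : ∑ᶠ α, Ideal.absNorm w.asIdeal •
            ({𝒮.geomReductionMap (AlgPoints.map (recordHeckeTranslateGS S hU7ₛ (r₂ α) N K (hrN₂ α)) x)} :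
              Multiset (AlgPoints 𝒮.reductionAt (geomResidueField w)))
      = Multiset.map uv
          (∑ᶠ β, Ideal.absNorm w.asIdeal •
              ({𝒮t.geomReductionMap (AlgPoints.map (recordHeckeTranslateGS S hU7ₛ (rt₂ β) N' Kt (hrtN'₂ β)) x')} :
                Multiset (AlgPoints 𝒮t.reductionAt (geomResidueField w)))) := by
    refine Eq.trans ?_ (multiset_map_finsum _ _).symm
    refine Eq.trans ?_ (finsum_comp_equiv e₂)
    refine finsum_congr fun α => ?_
    simp only [Multiset.map_nsmul, Multiset.map_singleton, hT₂ α, hC2a]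
  -- RIGHT side, first summand
  have hR₁ : ({AlgPoints.map (frobeniusOver 𝒮.reductionAt) (AlgPoints.map (frobeniusOver 𝒮.reductionAt)
            (𝒮.geomReductionMap (AlgPoints.map (S.M.map (homOfLE hNK)) x)))} :
              Multiset (AlgPoints 𝒮.reductionAt (geomResidueField w)))
      = Multiset.map uv
          {AlgPoints.map (frobeniusOver 𝒮t.reductionAt) (AlgPoints.map (frobeniusOver 𝒮t.reductionAt)
              (𝒮t.geomReductionMap (AlgPoints.map (S.M.map (homOfLE hN'Kt)) x')))} := by
    simp only [Multiset.map_singleton, hxK, hC2a, hFr]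
  -- assemble by an `Eq.trans` chain (no `rw` across the big goal: kabstract would compare `t₁`- and `t₂`-indexed sums)
  exact hL.trans (((congrArg (Multiset.map uv) hC3t).trans (Multiset.map_add uv _ _)).trans
    (congrArg₂ (· + ·) hR₁ hR₂).symm)

end Descent

end DescentLemmas

end Edition5Desk
end Summit.HodgeConjecture.HodgeConjecture.Cruxes.HLiu418.F0D9opRoad2
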